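/-
Copyright: see repository licence. Literature formalisation — Fitzner–van der Hofstad, NoBLE weighted diagrams:
the line shift `ℋ^{n,l+1}_p(u) = (2d)⁻¹ Σ_ι ℋ^{n,l}_p(u − e_ι)` in position space.
-/
import Literature.Probability.FitznerVanDerHofstad2017.NobleEntryAbarIotaStZeroTwo
import Literature.Probability.FitznerVanDerHofstad2017.SrwLawBridges
import HarnessLib

/-!
# [NoBLE17-I] (3.9): the line shift of the weighted diagram `ℋ^{n,l}_p` — one more `D`-step is a unit-offset average

[NoBLE17-I] = R. Fitzner, R. van der Hofstad, *Generalized approach to the non-backtracking lace expansion*,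
PTRF 169 (2017) 1041–1119 (arXiv:1506.07969); [FvdH17] = R. Fitzner, R. van der Hofstad, *Mean-field behavior for
nearest-neighbor percolation in d > 10*, EJP 22 (2017) no. 43 (arXiv:1506.07977v2).

[NoBLE17-I] (3.9) defines `ℋ^{n,l}_z(x) = Σ_y ‖y‖₂² G_z(y) (G_z^{⋆n} ⋆ D^{⋆l})(x − y)`; in the tree (percolation,
`G_z = τ_p`) this is `Literature.Barriers.CriticalPhenomena.nobleH d n l p x = Σ_y ‖y‖₂² τ_p(y) (τ_p^{⋆n} ⋆ D^{⋆l})(x − y)`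
with the lattice convolution `(f ⋆ g)(x) = Σ_y f(y) g(x − y)` and its powers `f^{⋆(l+1)} = f^{⋆l} ⋆ f`
(`SpreadOutIsing.latticeConv`, `SpreadOutIsing.convPow`), and `D(x) = 𝟙{|x| = 1}/(2d)` ([NoBLE17-I] (1.1), `srwStep d`).

## What this module proves (all statements kernel-checked; nothing is assumed)

* THE KERNEL SHIFT (hypothesis-free, `d ≥ 1`): for every `f : ℤ^d → ℝ`,
  `(f ⋆ D^{⋆(l+1)})(z) = (2d)⁻¹ Σ_ι (f ⋆ D^{⋆l})(z − e_ι)` (`latticeConv_convPow_srwStep_succ`), from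
  `D^{⋆(l+1)} = D^{⋆l} ⋆ D` (definition), commutativity of `⋆` (a reindexing, no summability), the neighbour-average
  form `(D ⋆ g)(w) = (2d)⁻¹ Σ_ι g(w − e_ι)` (`NobleEntryAbarIotaTwoTwo.sum_stepVec_eq_two_d_mul_latticeConv_srwStep`)
  and the finite support of `D^{⋆l}` (`SrwLawBridges.convPow_srwStep_eq_zero_of_not_mem_box`), which licenses the
  interchange of `Σ_ι` with the convolution sum for an ARBITRARY `f`.
* THE LINE SHIFT ([NoBLE17-I] (3.9)): `ℋ^{n,l+1}_p(u) = (2d)⁻¹ Σ_ι ℋ^{n,l}_p(u − e_ι)` for all `n, l`, all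
  `u ∈ ℤ^d`, `d ≥ 1`, under the summability binder `Summable (y ↦ ‖y‖₂² τ_p(y))` (`nobleH_succ_eq_avg`); the binder
  is what licenses the interchange of `Σ_ι` with the outer sum `Σ_y`: it implies `Summable τ_p` (`‖y‖₂ ≥ 1` off the
  origin, `summable_tau_of_summable_sq_mul_tau`), whence the kernel `τ_p^{⋆n} ⋆ D^{⋆l}` is bounded by
  `(Σ_x D^{⋆l}(x)) (Σ_x τ_p(x))^n` (`latticeConv_convPow_tau_srwStep_le`); at `u = 0`:
  `ℋ^{n,l+1}_p(0) = (2d)⁻¹ Σ_ι ℋ^{n,l}_p(e_ι)` (`nobleH_succ_zero_eq_avg`).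
* THE REINDEXING `Σ_ι F(e_ι − y) = Σ_ι F(−y − e_ι)` (`sum_stepVec_sub_eq_sum_neg_sub`; the step set is closed under
  `e ↦ −e`, no evenness of `F` is used).

## Relation to the tree (no duplicate)

`F3BoundsCellReductionAltPhi.nobleH_single (hd : 2 ≤ d) (n l) (p) (hp : p < p_c) (i) :
nobleH d n l p (Pi.single i 1) = nobleH d n (l + 1) p 0` ([NoBLE17-I] §3.3.4 (3.34)–(3.35), proved there through
the Fourier representation `nobleH_eq_integral`) is the `u = 0`, single-unit-vector special case: for a
`ℤ^d`-symmetric `ℋ^{n,l}_p` all `2d` terms of the average `(2d)⁻¹ Σ_ι ℋ^{n,l}_p(e_ι)` coincide.  The present module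
is the position-space statement for GENERAL `u` and `n`, `d ≥ 1`, under the summability binder only, with a
different (elementary) proof; it neither restates nor uses `nobleH_single`.  The convolution reading of `nobleH`
(`NobleWeightedDiagramFourier.nobleH_eq_latticeConv`, `GaussianDominationRouteNobleProofs.nobleH_eq_latticeConv`,
both `rfl`) is used here in its definitional form.

## Reading notes

(1) `d ≥ 1` is needed only because the step set `{e_ι}` must be the `2d` neighbours of `0` with `2d ≠ 0`; `d ≥ 2`
and `p < p_c` enter nowhere (a summability supplier for the binder is
`GaussianDominationRouteNobleProofs.summable_euclidNorm_sq_mul_tau`, `d ≥ 2`, `p < p_c`).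
(2) Downstream ([FvdH17] App. B, the weighted exit matrix `H^{(3)}`) only `n = 1` is used: `ℋ^{1,1}_p → ℋ^{1,2}_p →
ℋ^{1,3}_p` under the class-`1̲` unit-offset averages.
(3) No numerals other than `2d`; no identification of `2dp ℋ^{1,l}_p` with any numerical cell is made here.
-/

noncomputable section

namespace Literature.Probability.FitznerVanDerHofstad2017.NobleBlocks

open Literature.Probability.LatticeModels Literature.Probability.Percolation
open Literature.Barriers.CriticalPhenomena (euclidNorm euclidNorm_nonneg srwStep nobleH srwStep_nonneg
  summable_euclidNorm_sq_mul_tau nobleKernel_nonneg summable_convPow_srwStep convPow_srwStep_nonneg)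
open Literature.Probability.FitznerVanDerHofstad2017.UnitVectorPairs (opp opp_opp)
open Literature.Barriers.CriticalPhenomena.SpreadOutIsing (latticeConv convPow latticeConv_comm convPow_succ
  abs_latticeConv_le_of_bdd abs_convPow_le one_le_euclidNorm_of_ne_zero)
open scoped BigOperators

local notation "𝐞" => Literature.Probability.Percolation.stepVec

variable {d : ℕ}

/-! ## A. The kernel shift `(f ⋆ D^{⋆(l+1)})(z) = (2d)⁻¹ Σ_ι (f ⋆ D^{⋆l})(z − e_ι)` -/

/-- `w ↦ f(w) D^{⋆l}(b − w)` has finite support (`D^{⋆l}` vanishes off the box of radius `l`), hence is summable for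
every `f`. [cite: FitznerVanDerHofstad2016NoBLE, (1.1) (`D(x) = 𝟙{|x| = 1}/(2d)`)] -/
theorem summable_mul_convPow_srwStep_sub (f : Site d → ℝ) (l : ℕ) (b : Site d) :
    Summable fun w => f w * convPow (srwStep d) l (b - w) := by
  refine summable_of_ne_finset_zero (s := (box d l).image fun c => b - c) fun w hw => ?_
  have hb : b - w ∉ box d l := fun h => hw (Finset.mem_image.2 ⟨b - w, h, sub_sub_cancel b w⟩)
  rw [convPow_srwStep_eq_zero_of_not_mem_box hb, mul_zero]

/-- **The kernel shift**: `(f ⋆ D^{⋆(l+1)})(z) = (2d)⁻¹ Σ_ι (f ⋆ D^{⋆l})(z − e_ι)` for every `f : ℤ^d → ℝ` (`d ≥ 1`):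
`D^{⋆(l+1)} = D^{⋆l} ⋆ D = D ⋆ D^{⋆l}` and `(D ⋆ g)(w) = (2d)⁻¹ Σ_ι g(w − e_ι)`.
[cite: FitznerVanDerHofstad2016NoBLE, (3.9) and (1.1)–(1.3)] -/
theorem latticeConv_convPow_srwStep_succ (hd : 1 ≤ d) (f : Site d → ℝ) (l : ℕ) (z : Site d) :
    latticeConv f (convPow (srwStep d) (l + 1)) z =
      (2 * (d : ℝ))⁻¹ * ∑ ι : Fin d × Bool, latticeConv f (convPow (srwStep d) l) (z - 𝐞 ι) := by
  have hne : (2 * (d : ℝ)) ≠ 0 := by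
    have h1 : (1 : ℝ) ≤ d := by exact_mod_cast hd
    positivity
  have hD : ∀ w : Site d, latticeConv (convPow (srwStep d) l) (srwStep d) w =
      (2 * (d : ℝ))⁻¹ * ∑ ι : Fin d × Bool, convPow (srwStep d) l (w - 𝐞 ι) := by
    intro w
    rw [latticeConv_comm, sum_stepVec_eq_two_d_mul_latticeConv_srwStep hd, ← mul_assoc, inv_mul_cancel₀ hne,
      one_mul]
  rw [convPow_succ]
  show ∑' w, f w * latticeConv (convPow (srwStep d) l) (srwStep d) (z - w) = _
  simp only [hD, Finset.mul_sum, mul_left_comm (f _) (2 * (d : ℝ))⁻¹]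
  rw [Summable.tsum_finsetSum fun ι _ => (summable_mul_convPow_srwStep_sub f l (z - 𝐞 ι)).mul_left _ |>.congr
      fun w => by rw [sub_right_comm]]
  refine Finset.sum_congr rfl fun ι _ => ?_
  rw [tsum_mul_left]
  congr 1
  refine tsum_congr fun w => ?_
  rw [sub_right_comm]

/-- The summability binder `Σ_y ‖y‖₂² τ_p(y) < ∞` implies `Σ_y τ_p(y) < ∞` (`‖y‖₂ ≥ 1` for `y ≠ 0`, `τ_p(0) = 1`).
[cite: FitznerVanDerHofstad2016NoBLE, Assumption 2.3 and (1.2)–(1.3)] -/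
theorem summable_tau_of_summable_sq_mul_tau {p : unitInterval}
    (hH : Summable fun y : Site d => euclidNorm y ^ 2 * tau d p 0 y) : Summable fun y : Site d => tau d p 0 y := by
  have hg : Summable fun y : Site d => if y = 0 then (1 : ℝ) else 0 :=
    summable_of_ne_finset_zero (s := {0}) fun y hy => if_neg (by simpa using hy)
  refine Summable.of_nonneg_of_le (fun y => tau_nonneg p 0 y) (fun y => ?_) (hH.add hg)
  by_cases hy : y = 0
  · subst hy
    simp
  · rw [if_neg hy, add_zero]
    have h1 : (1 : ℝ) ≤ euclidNorm y ^ 2 := one_le_pow₀ (one_le_euclidNorm_of_ne_zero hy)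
    exact le_mul_of_one_le_left (tau_nonneg p 0 y) h1

/-- The kernel `τ_p^{⋆n} ⋆ D^{⋆l}` is bounded: `(τ_p^{⋆n} ⋆ D^{⋆l})(z) ≤ (Σ_x D^{⋆l}(x)) (Σ_x τ_p(x))^n` whenever
`Σ_x τ_p(x) < ∞` (`|τ_p^{⋆n}| ≤ (Σ τ_p)^n` pointwise, `ℓ¹ × ℓ^∞`).
[cite: FitznerVanDerHofstad2016NoBLE, Lemma 3.5 (proof: `sup_y (G_z^{⋆n} ⋆ D^{⋆l})(y) ≤ χ^n`)] -/
theorem latticeConv_convPow_tau_srwStep_le {p : unitInterval} (hτ : Summable fun y : Site d => tau d p 0 y)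
    (n l : ℕ) (z : Site d) :
    latticeConv (convPow (tau d p 0) n) (convPow (srwStep d) l) z ≤
      (∑' x, convPow (srwStep d) l x) * (∑' x, tau d p 0 x) ^ n := by
  have hτa : Summable fun y : Site d => |tau d p 0 y| := hτ.congr fun y => (abs_of_nonneg (tau_nonneg p 0 y)).symm
  have hDa : Summable fun y : Site d => |convPow (srwStep d) l y| :=
    (summable_convPow_srwStep l).congr fun y => (abs_of_nonneg (convPow_srwStep_nonneg l y)).symm
  have h := abs_latticeConv_le_of_bdd hDa (abs_convPow_le hτa n) z
  rw [latticeConv_comm] at h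
  have e1 : ∑' y, |convPow (srwStep d) l y| = ∑' y, convPow (srwStep d) l y :=
    tsum_congr fun y => abs_of_nonneg (convPow_srwStep_nonneg l y)
  have e2 : ∑' y, |tau d p 0 y| = ∑' y, tau d p 0 y := tsum_congr fun y => abs_of_nonneg (tau_nonneg p 0 y)
  rw [e1, e2] at h
  exact (le_abs_self _).trans h

/-! ## B. The line shift `ℋ^{n,l+1}_p(u) = (2d)⁻¹ Σ_ι ℋ^{n,l}_p(u − e_ι)` -/

/-- **The line shift of the weighted diagram** ([NoBLE17-I] (3.9)):
`ℋ^{n,l+1}_p(u) = (2d)⁻¹ Σ_ι ℋ^{n,l}_p(u − e_ι)` for all `n, l`, all `u`, `d ≥ 1`, under `Σ_y ‖y‖₂² τ_p(y) < ∞`.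
[cite: FitznerVanDerHofstad2016NoBLE, (3.9) and (1.1)–(1.3); §3.3.4 (3.34)–(3.35)] -/
theorem nobleH_succ_eq_avg (hd : 1 ≤ d) {p : unitInterval}
    (hH : Summable fun y : Site d => euclidNorm y ^ 2 * tau d p 0 y) (n l : ℕ) (u : Site d) :
    nobleH d n (l + 1) p u = (2 * (d : ℝ))⁻¹ * ∑ ι : Fin d × Bool, nobleH d n l p (u - 𝐞 ι) := by
  have hK : ∀ (ι : Fin d × Bool), Summable fun y : Site d =>
      euclidNorm y ^ 2 * tau d p 0 y * latticeConv (convPow (tau d p 0) n) (convPow (srwStep d) l) (u - 𝐞 ι - y) := by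
    intro ι
    refine Summable.of_nonneg_of_le (fun y => mul_nonneg (mul_nonneg (sq_nonneg _) (tau_nonneg p 0 y))
      (nobleKernel_nonneg n l p _)) (fun y => ?_)
      (hH.mul_right ((∑' x, convPow (srwStep d) l x) * (∑' x, tau d p 0 x) ^ n))
    exact mul_le_mul_of_nonneg_left (latticeConv_convPow_tau_srwStep_le (summable_tau_of_summable_sq_mul_tau hH) n l _)
      (mul_nonneg (sq_nonneg _) (tau_nonneg p 0 y))
  unfold nobleH
  simp only [latticeConv_convPow_srwStep_succ hd, Finset.mul_sum, mul_left_comm _ (2 * (d : ℝ))⁻¹]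
  rw [Summable.tsum_finsetSum fun ι _ => ((hK ι).mul_left (2 * (d : ℝ))⁻¹).congr fun y => by rw [sub_right_comm]]
  refine Finset.sum_congr rfl fun ι _ => ?_
  rw [tsum_mul_left]
  congr 1
  refine tsum_congr fun y => ?_
  rw [sub_right_comm]

/-- `Σ_ι F(e_ι − y) = Σ_ι F(−y − e_ι)`: the step set `{e_ι}` is closed under `e ↦ −e`.
[cite: FitznerVanDerHofstad2016NoBLE, (1.1) (`D` is symmetric)] -/
theorem sum_stepVec_sub_eq_sum_neg_sub {M : Type*} [AddCommMonoid M] (F : Site d → M) (y : Site d) :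
    ∑ ι : Fin d × Bool, F (𝐞 ι - y) = ∑ ι : Fin d × Bool, F (-y - 𝐞 ι) := by
  have hopp : ∀ κ : Fin d × Bool, (𝐞 (opp κ) : Site d) = -𝐞 κ := by
    rintro ⟨i, b⟩; cases b <;> simp [Percolation.stepVec, opp]
  let e : Fin d × Bool ≃ Fin d × Bool := ⟨opp, opp, opp_opp, opp_opp⟩
  rw [← Equiv.sum_comp e]
  refine Finset.sum_congr rfl fun κ _ => ?_
  show F (𝐞 (opp κ) - y) = F (-y - 𝐞 κ)
  rw [hopp, show -(𝐞 κ : Site d) - y = -y - 𝐞 κ by abel]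

/-- **The line shift at the origin**: `ℋ^{n,l+1}_p(0) = (2d)⁻¹ Σ_ι ℋ^{n,l}_p(e_ι)` (`d ≥ 1`, `Σ_y ‖y‖₂² τ_p(y) < ∞`);
for a `ℤ^d`-symmetric `ℋ^{n,l}_p` every term equals `ℋ^{n,l}_p(e_1)` — the shape of the tree's `nobleH_single`
(which is proved there for `d ≥ 2`, `p < p_c` by Fourier inversion and is not used here).
[cite: FitznerVanDerHofstad2016NoBLE, §3.3.4 (3.34)–(3.35); (3.9)] -/
theorem nobleH_succ_zero_eq_avg (hd : 1 ≤ d) {p : unitInterval}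
    (hH : Summable fun y : Site d => euclidNorm y ^ 2 * tau d p 0 y) (n l : ℕ) :
    nobleH d n (l + 1) p 0 = (2 * (d : ℝ))⁻¹ * ∑ ι : Fin d × Bool, nobleH d n l p (𝐞 ι) := by
  rw [nobleH_succ_eq_avg hd hH n l 0]
  congr 1
  have h := sum_stepVec_sub_eq_sum_neg_sub (nobleH d n l p) 0
  simp only [sub_zero, neg_zero, zero_sub] at h ⊢
  exact h.symm

end Literature.Probability.FitznerVanDerHofstad2017.NobleBlocks

end
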